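import Mathlib
import Summits.Parity.GeneralizedHardyLittlewood.Theorems.FordMaynardSieveConst01651SieveConst01651BuchstabCert
import HarnessLib

/-!
# Route `FordMaynardSieveConst01651`, target `SieveConst01651` (stmt-Parity-19185), stub `stub_certValuePos` (R2):
# shape of the checker's rectangles

Def-free helper file (step (5) of the `certP`/`certN` soundness, see `…CertAssembly`): what a member of
`rowSplit` / `colSplit` / `entryRects` looks like.  Every rectangle `(u₀, u₁, v₀, v₁)` produced for the entry
`(a, b, j)` has `E_a ≤ u₀ < u₁ ≤ E_a + 283` (`E_a = 19812 + 283a`) and `vlo(u) ≤ v₀ < v₁ ≤ vhi(u)` with the column's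
band / half limits (`entryRects_mem`): inner rectangles satisfy `E_b ≤ v₀`, `v₁ ≤ E_b + 283`, `v₁ + u₁ ≤ hiB`, and for
`j = 1` also `50094 ≤ v₀ + u₀`; outer ones `E_b ≤ v₀`, `v₁ ≤ E_b + 283`, `v₁ ≤ hiB − u₀`… as recorded below.

References: folklore.
-/

namespace Summit.Parity.GeneralizedHardyLittlewood.FordMaynardSieveConst01651SieveConst01651

/-- Members of `rowSplit`: the column is kept and the row piece lies in `[v₀, vhi]`, non-degenerate. [folklore] -/
theorem rowSplit_mem : ∀ (f u0 u1 v0 vhi : ℕ) (r : ℕ × ℕ × ℕ × ℕ), r ∈ rowSplit f u0 u1 v0 vhi →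
    r.1 = u0 ∧ r.2.1 = u1 ∧ v0 ≤ r.2.2.1 ∧ r.2.2.1 < r.2.2.2 ∧ r.2.2.2 ≤ vhi
  | 0, u0, u1, v0, vhi, r, hr => by simp [rowSplit] at hr
  | f + 1, u0, u1, v0, vhi, r, hr => by
    rw [rowSplit] at hr
    by_cases h : v0 < vhi
    · rw [if_pos h, List.mem_cons] at hr
      rcases hr with rfl | hr
      · refine ⟨rfl, rfl, le_rfl, ?_, ?_⟩
        · show v0 < min (v0 + 142) vhi
          exact lt_min (by omega) h
        · exact min_le_right _ _
      · obtain ⟨h1, h2, h3, h4, h5⟩ := rowSplit_mem f u0 u1 (min (v0 + 142) vhi) vhi r hr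
        exact ⟨h1, h2, le_trans (le_min (by omega) h.le) h3, h4, h5⟩
    · rw [if_neg h] at hr; simp at hr

/-- Members of `colSplit` (`g > 0`): produced by `col a b` on a column `u₀ ≤ a < b ≤ uE`, `b ≤ a + g`. [folklore] -/
theorem colSplit_mem {g : ℕ} (hg : 0 < g) (uE : ℕ) (col : ℕ → ℕ → List (ℕ × ℕ × ℕ × ℕ)) :
    ∀ (f u0 : ℕ) (r : ℕ × ℕ × ℕ × ℕ), r ∈ colSplit g uE col f u0 →
      ∃ a b, u0 ≤ a ∧ a < b ∧ b ≤ uE ∧ b ≤ a + g ∧ r ∈ col a b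
  | 0, u0, r, hr => by simp [colSplit] at hr
  | f + 1, u0, r, hr => by
    rw [colSplit] at hr
    by_cases h : u0 < uE
    · rw [if_pos h, List.mem_append] at hr
      rcases hr with hr | hr
      · exact ⟨u0, min (u0 + g) uE, le_rfl, lt_min (by omega) h, min_le_right _ _, min_le_left _ _, hr⟩
      · obtain ⟨a, b, h1, h2, h3, h4, h5⟩ := colSplit_mem hg uE col f (min (u0 + g) uE) r hr
        exact ⟨a, b, le_trans (le_min (by omega) h.le) h1, h2, h3, h4, h5⟩
    · rw [if_neg h] at hr; simp at hr

/-- **Members of `entryRects a b j inner`**: a column `[u₀, u₁) ⊆ [E_a, E_a + 283)` of width `≤ 142` (or `≤ 9` on the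
cut cells) and a row piece `[v₀, v₁)` inside the column's limits
`vlo = (j = 1 ? max E_b (50094 − u*) : E_b)`, `vhi = min (E_b + 283) (hiB − u*)` (`u* = u₀/u₁` for inner, `u₁/u₀` for
outer; `hiB = 50094` for `j = 0`, else `60000`). [folklore] -/
theorem entryRects_mem (a b j : ℕ) (inner : Bool) (r : ℕ × ℕ × ℕ × ℕ) (hr : r ∈ entryRects a b j inner) :
    ∃ u0 u1, 19812 + a * 283 ≤ u0 ∧ u0 < u1 ∧ u1 ≤ 19812 + a * 283 + 283 ∧
      r.1 = u0 ∧ r.2.1 = u1 ∧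
      (if j == 1 then max (19812 + b * 283) (50094 - (if inner then u0 else u1)) else 19812 + b * 283) ≤ r.2.2.1 ∧
      r.2.2.1 < r.2.2.2 ∧
      r.2.2.2 ≤ min (19812 + b * 283 + 283) ((if j == 0 then 50094 else 60000) - (if inner then u1 else u0)) := by
  unfold entryRects at hr
  simp only at hr
  have hg : 0 < (if ((a + b == 35) || (a + b == 36) || (a + b == 71)) = true then 9 else 142) := by
    split_ifs <;> norm_num
  obtain ⟨u0, u1, h1, h2, h3, -, h5⟩ := colSplit_mem hg _ _ 32 (19812 + a * 283) r hr
  obtain ⟨e1, e2, e3, e4, e5⟩ := rowSplit_mem 3 u0 u1 _ _ r h5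
  exact ⟨u0, u1, h1, h2, h3, e1, e2, e3, e4, e5⟩

end Summit.Parity.GeneralizedHardyLittlewood.FordMaynardSieveConst01651SieveConst01651
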